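import Summits.AtomisticToContinuum.Crystallization.Theorems.ExcessDecayLiouvilleInductionStepA
import Summits.AtomisticToContinuum.Crystallization.Theorems.ExcessDecayLiouvilleStepEnergyBoundAbs

/-!
# Route `ExcessDecayLiouville`: the induction step, part A, mass currencies and absorbed forcing (nonlinear half, XXVI″)

Harmonic-replacement architecture for item `ExcessDecay` (stmt-AtomisticToContinuum-9334), nonlinear half.
`step_correction_abs` is `step_correction` with (i) the pointwise cubic envelope replaced by its mass consequence
`𝐌[v, X] ≤ 32 C X⁶` (`max(1,ρ) ≤ X ≤ r/4`) and (ii) the gradient currency taken in its absorbed-forcing form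
(`step_energy_le_abs`): in the energy bound of the Dirichlet correction the gradient quintic carries the doubled
coefficients `2𝔮₁ … 2𝔮₄` and the forcing coefficient `(2048/κ²)(1178/189)² 𝚽²`, quadratic in the forcing
floor.  Flux smallness `4·10⁶ Λ ≤ κ/16`.  Proof verbatim up to the replaced call.
All `[folklore]`; helper lemmas, nothing here closes an item.
-/

noncomputable section

namespace Summit.AtomisticToContinuum.Crystallization.Theorems.ExcessDecayLiouville

open scoped BigOperators Topology InnerProductSpace RealInnerProductSpace Classical
open Literature.MathematicalPhysics.StatisticalMechanics
open Summit.AtomisticToContinuum.Crystallization.Theorems.PhononStabilityNegative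

-- Local notation: the force-constant map `K(e)w = h(|e|²)w + 2⟪e,w⟫h′(|e|²)e`.
local notation3 "𝕂[" e "] " w:max =>
  (-((‖e‖ ^ 2)⁻¹) ^ 7 + ((‖e‖ ^ 2)⁻¹) ^ 4) • w + (2 * ⟪e, w⟫ * (7 * ((‖e‖ ^ 2)⁻¹) ^ 8 - 4 * ((‖e‖ ^ 2)⁻¹) ^ 5)) • e
-- Local notation: the pair force `F(x) = h(|x|²) x`.
local notation3 "𝐅[" x "]" => ((-((‖x‖ ^ 2)⁻¹) ^ 7 + ((‖x‖ ^ 2)⁻¹) ^ 4) • x)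
set_option quotPrecheck false in
-- Local notation: ball indicator.
local notation "𝟙ᵇ[" x ", " c ", " R "]" => (if dist (x : EuclideanSpace ℝ (Fin 3)) c ≤ R then (1 : ℝ) else 0)

section

variable {X : Set (EuclideanSpace ℝ (Fin 3))} {c : EuclideanSpace ℝ (Fin 3)} {r ε δ κ : ℝ}
  {t : Fin 2 → EuclideanSpace ℝ (Fin 3)} {A : EuclideanSpace ℝ (Fin 3) →L[ℝ] EuclideanSpace ℝ (Fin 3)}
  {π : EuclideanSpace ℝ (Fin 3) → EuclideanSpace ℝ (Fin 3)}
  {aff : (EuclideanSpace ℝ (Fin 3)) → (EuclideanSpace ℝ (Fin 3))} {a : Fin 2 → EuclideanSpace ℝ (Fin 3)}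
  {B : (EuclideanSpace ℝ (Fin 3)) →L[ℝ] (EuclideanSpace ℝ (Fin 3))} {c₀ : EuclideanSpace ℝ (Fin 3)}

variable (hA : Adm₀ A) (hI : Inner₀ t A)

set_option quotPrecheck false in
-- Local notation: the operator row `(L v)(p)`.
local notation "𝕃" v:max " @ " p:max =>
  tsum (fun q : Sites₀ t A => (if ((p : Sites₀ t A) : EuclideanSpace ℝ (Fin 3)) ≠ q then
    𝕂[((p : Sites₀ t A) : EuclideanSpace ℝ (Fin 3)) - q] (v ((p : Sites₀ t A) : EuclideanSpace ℝ (Fin 3)) - v q) else 0))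
set_option quotPrecheck false in
-- Local notation: the finite near-neighbour form on the ball of radius `X` about `c₀`.
local notation "NN[" v ", " X "]" =>
  (∑ p ∈ (finite_sites_dist_le (t := t) (A := A) hA hI c₀ X).toFinset,
    ∑ q ∈ (finite_sites_dist_le (t := t) (A := A) hA hI c₀ X).toFinset,
      (if p ≠ q ∧ dist p q ≤ 11 / 10 then ‖v p - v q‖ ^ 2 else (0 : ℝ)))
set_option quotPrecheck false in
-- local mass on the ball of radius `X` about `c₀`
local notation "𝐌[" f ", " X "]" =>
  tsum (fun p : Sites₀ t A => ‖f (p : EuclideanSpace ℝ (Fin 3))‖ ^ 2 * 𝟙ᵇ[p, c₀, X])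

-- the gradient currency as a quintic: coefficients (as in `StepEnergyBound`)
local notation "𝔮₁[" κ ", " Λ' ", " C "]" => ((64 * (2 / κ) * (131072 * (38 * 4 ^ 5 * (1024 / (23 / 25 : ℝ) ^ 3)) +
          Λ' * 3200000 * (1024 / (23 / 25 : ℝ) ^ 3) * 72704) * C + 64 * 120 ^ 5 * 327680 * C +
        4 / κ * (Λ' * 32768 * 256 * C + 1245184 * 4096 * C)))
local notation "𝔮₂[" κ ", " Λ' ", " Dv ", " r "]" => ((4 / κ * (Λ' * 32768 * 8192 * (7 * r / 8) ^ 3 * Dv ^ 2 / ((r / 4) ^ 7 * 4) +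
        1245184 * 8192 * (7 * r / 8) ^ 3 * Dv ^ 2 / (r / 4) ^ 7)))
local notation "𝔮₃[" κ ", " Λ' ", " D₀ ", " r "]" => ((4 / κ * (Λ' * 32768 * (32 * r ^ 3 * ((3 * r / 8)⁻¹ ^ 8 * (D₀ / 2) ^ 2)))))
local notation "𝔮₄[" κ ", " C "]" => ((2 ^ (5 + 1) * (2 / κ * (19 * 16 * (1024 / ((23 / 25 : ℝ) ^ 3 * (23 / 25 : ℝ) ^ 3))) +
        16 * (11 / 10 : ℝ) ^ 8 * (1024 / ((23 / 25 : ℝ) ^ 3 * (23 / 25 : ℝ) ^ 3))) * (32 * 4 ^ 6) * C))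
local notation "𝔮₅[" κ ", " C ", " Φ₀ "]" => ((4 / κ * (16 * Real.sqrt (2048 * C) * Φ₀)))
set_option quotPrecheck false in
-- the forcing constant on `B_{r/4}(c)`
local notation "𝚽[" Du ", " r ", " δ "]" => (31488 * (1024 / ((23 / 25 : ℝ) ^ 3 * (r / 2) ^ 4)) + 2048 / (δ ^ 3 * (r / 4) ^ 4) +
        (38 * Du * (1024 / ((23 / 25 : ℝ) ^ 3 * (r / 4) ^ 5)) + 38 * Du * (1024 / ((23 / 25 : ℝ) ^ 3 * (r / 2) ^ 5))))

include hA hI in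
/-- **Induction step, part A: the correction and its energy** (see the module docstring). [folklore] -/
theorem step_correction_abs (hκ0 : 0 < κ)
    (hκ : ∀ v : (EuclideanSpace ℝ (Fin 3)) → (EuclideanSpace ℝ (Fin 3)), (Function.support v).Finite →
      Function.support v ⊆ Sites₀ t A → κ * nnForm t A v ≤ ∑' p : Sites₀ t A, ⟪𝕃 v @ p, v p⟫)
    (hX : X.Finite) (hsep : Sep₀ X δ) (hequil : Equil₀ X) (hδ : 0 < δ) (hδ1 : δ ≤ 1)
    (hε0 : 0 ≤ ε) (hε : 2 * ε < δ) (hr : 8 ≤ r)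
    (hXb : ∀ p ∈ X, dist p c ≤ r → ∃ m : Fin 2, ∃ z ∈ Λ₀, dist p (t m + A z) ≤ ε)
    (hπ : ∀ s' ∈ Sites₀ t A, dist s' c ≤ r → π s' ∈ X ∧ dist (π s') s' ≤ ε)
    (hinj : ∀ s₁ ∈ Sites₀ t A, ∀ s₂ ∈ Sites₀ t A, dist s₁ c ≤ r → dist s₂ c ≤ r → π s₁ = π s₂ → s₁ = s₂)
    (SR : Finset (EuclideanSpace ℝ (Fin 3))) (hSR : ∀ x, x ∈ SR ↔ x ∈ Sites₀ t A ∧ dist x c ≤ r)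
    (χ : EuclideanSpace ℝ (Fin 3) → ℝ) (hχ0 : ∀ q ∈ Sites₀ t A, q ∉ SR → χ q = 0) (hχS : ∀ x, x ∉ Sites₀ t A → χ x = 0)
    (hχabs : ∀ x, |χ x| ≤ 1) (hχ1abs : ∀ x, |1 - χ x| ≤ 1) (hχone : ∀ q ∈ SR, dist q c ≤ r / 2 → χ q = 1)
    (haff : ∀ (m : Fin 2) (z : EuclideanSpace ℝ (Fin 3)), z ∈ Λ₀ → aff (t m + A z) = a m + B (t m + A z - c₀))
    (hrelax : ∀ s : Sites₀ t A, (∑' q : Sites₀ t A, (if (s : EuclideanSpace ℝ (Fin 3)) ≠ q then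
        𝐅[((s : EuclideanSpace ℝ (Fin 3)) - q) + (aff s - aff q)] else 0)) = 0)
    (ha : ‖a 0 - a 1‖ ≤ 1 / 100) (hBr : 2 * r * ‖B‖ ≤ 1 / 100)
    (v ut : (EuclideanSpace ℝ (Fin 3)) → (EuclideanSpace ℝ (Fin 3)))
    (hvdef : v = fun x => χ x • ((π x - x) - aff x)) (hudef : ut = fun x => (π x - x) - aff x)
    {Du : ℝ} (hDu0 : 0 ≤ Du) (hDu1 : Du ≤ 1 / 20) (hDu : ∀ x ∈ SR, ‖ut x‖ ≤ Du)
    (hΛκ : 4000000 * (210000 * ((25 / 23) * (2 * Du + ‖a 0 - a 1‖) + ‖B‖)) ≤ κ / 16)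
    (hv : (Function.support v).Finite) (hc₀ : dist c₀ c ≤ r / 8)
    (φ : (EuclideanSpace ℝ (Fin 3)) → (EuclideanSpace ℝ (Fin 3)))
    (hφdef : φ = fun s : EuclideanSpace ℝ (Fin 3) =>
          (-(∑ s' ∈ SR.erase s, 𝐅[(s - s') + (aff s - aff s')]) -
            (∑ q ∈ (hX.toFinset.erase (π s)) \ ((SR.erase s).image π),
              (deriv lennardJones (dist (π s) q) / dist (π s) q) • (π s - q)) +
            ((∑ s' ∈ SR.erase s, 𝕂[s - s'] ((1 - χ s') • ((π s' - s') - aff s'))) +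
              ∑' q : ↑((SR.subtype (· ∈ Sites₀ t A) : Set (Sites₀ t A)))ᶜ,
                (if s ≠ (q : EuclideanSpace ℝ (Fin 3)) then 𝕂[s - (q : EuclideanSpace ℝ (Fin 3))] ((π s - s) - aff s) else 0))))
    {C ρ Dv : ℝ} (hC : 0 ≤ C) (hρ : 64 ≤ ρ) (hρr : 737600 * ρ + 153600 ≤ r)
    (hmass : ∀ Xr : ℝ, 1 ≤ Xr → ρ ≤ Xr → Xr ≤ r / 4 → 𝐌[v, Xr] ≤ 32 * C * Xr ^ 6)
    (hvD : ∀ x, ‖v x‖ ≤ Dv)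
    (hsupp : ∀ x ∈ Sites₀ t A, 7 * r / 8 < dist x c₀ → v x = 0) :
    (∀ (p : Sites₀ t A), (p : EuclideanSpace ℝ (Fin 3)) ∈ SR → dist (p : EuclideanSpace ℝ (Fin 3)) c ≤ r / 4 → ‖φ p‖ ≤ 𝚽[Du, r, δ]) ∧
    ∃ w : (EuclideanSpace ℝ (Fin 3)) → (EuclideanSpace ℝ (Fin 3)),
      Function.support w ⊆ (finite_sites_dist_le (t := t) (A := A) hA hI c₀ (2 * (1280 * (9 * ρ) + 2388) + 4)).toFinset ∧
      (Function.support w).Finite ∧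
      (∀ p : Sites₀ t A, dist (p : EuclideanSpace ℝ (Fin 3)) c₀ ≤ 2 * (1280 * (9 * ρ) + 2388) + 4 →
        𝕃 (fun x => v x + w x) @ p = 0) ∧
      ∑' p : Sites₀ t A, ‖w p‖ ^ 2 ≤ (400 * (2 * (1280 * (9 * ρ) + 2388) + 4) / 189 + 2) ^ 2 * nnForm t A w ∧
      nnForm t A w ≤ 2 * (((Real.sqrt (32 * (2 * (1280 * (9 * ρ) + 2388) + 4) ^ 3) * 𝚽[Du, r, δ] +
        (210000 * ((25 / 23) * (2 * ((2 * Du) / 2) + ‖a 0 - a 1‖) + ‖B‖)) * (3 * (1024 / ((23 / 25 : ℝ) ^ 3 * ρ ^ 5)) *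
            Real.sqrt (32 * C * (2 * (1280 * (9 * ρ) + 2388) + 4) ^ 6) +
          Real.sqrt (1024 / ((23 / 25 : ℝ) ^ 3 * ρ ^ 5)) * Real.sqrt
            ((1024 / ((23 / 25 : ℝ) ^ 3 * ρ ^ 5)) * (32 * C * (2 * (2 * (1280 * (9 * ρ) + 2388) + 4)) ^ 6) +
              8192 * (2 * (1280 * (9 * ρ) + 2388) + 4) ^ 3 *
                ((4096 * C / (2 * (2 * (1280 * (9 * ρ) + 2388) + 4)) ^ 2 +
                    8192 * (7 * r / 8) ^ 3 * Dv ^ 2 / ((r / 4) ^ 7 * (2 * (2 * (1280 * (9 * ρ) + 2388) + 4)))) +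
                  32 * r ^ 3 * ((3 * r / 8)⁻¹ ^ 8 * ((2 * Du) / 2) ^ 2))))) *
          (400 * (2 * (1280 * (9 * ρ) + 2388) + 4) / 189 + 2)) ^ 2 +
        (4000000 * (210000 * ((25 / 23) * (2 * ((2 * Du) / 2) + ‖a 0 - a 1‖) + ‖B‖)) *
          Real.sqrt (2 * 𝔮₁[κ, (210000 * ((25 / 23) * ((2 * Du) + ‖a 0 - a 1‖) + ‖B‖)), C] *
              ((2 * (1280 * (9 * ρ) + 2388) + 4) + 10 * ρ + 20) +
            2 * 𝔮₂[κ, (210000 * ((25 / 23) * ((2 * Du) + ‖a 0 - a 1‖) + ‖B‖)), Dv, r] *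
              ((2 * (1280 * (9 * ρ) + 2388) + 4) + 10 * ρ + 20) ^ 2 +
            2 * 𝔮₃[κ, (210000 * ((25 / 23) * ((2 * Du) + ‖a 0 - a 1‖) + ‖B‖)), (2 * Du), r] *
              ((2 * (1280 * (9 * ρ) + 2388) + 4) + 10 * ρ + 20) ^ 3 +
            2 * 𝔮₄[κ, C] * ((2 * (1280 * (9 * ρ) + 2388) + 4) + 10 * ρ + 20) ^ 4 +
            (2048 / κ ^ 2 * (1178 / 189 : ℝ) ^ 2 * (𝚽[Du, r, δ]) ^ 2) *
              ((2 * (1280 * (9 * ρ) + 2388) + 4) + 10 * ρ + 20) ^ 5)) ^ 2) / κ ^ 2 := by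
  have hSRS : ∀ x ∈ SR, x ∈ Sites₀ t A := fun x hx => ((hSR x).1 hx).1
  have hr0 : 0 < r := by linarith
  have hBn : 0 ≤ ‖B‖ := norm_nonneg _
  have hB50 : ‖B‖ ≤ 1 / 50 := by nlinarith
  -- the forcing bound (valid in the lambda form, then folded)
  have hDu' : ∀ x ∈ SR, ‖(π x - x) - aff x‖ ≤ Du := fun x hx => by have := hDu x hx; rw [hudef] at this; exact this
  have hforce := step_forcing hA hI hX hsep hδ hδ1 hε0 hε hr hXb hπ haff (by linarith) hB50 hrelax SR hSR χ hχ1abs hχone hDu0 hDu'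
  have hφ : ∀ (p : Sites₀ t A), (p : EuclideanSpace ℝ (Fin 3)) ∈ SR → dist (p : EuclideanSpace ℝ (Fin 3)) c ≤ r / 4 →
      ‖φ p‖ ≤ 𝚽[Du, r, δ] := by
    intro p hp hpc
    rw [hφdef]
    exact hforce p hp hpc
  refine ⟨hφ, ?_⟩
  -- the correction
  have hv' : (Function.support (fun x => χ x • ((π x - x) - aff x))).Finite := by rw [hvdef] at hv; exact hv
  have hρ'1 : (1 : ℝ) ≤ 2 * (1280 * (9 * ρ) + 2388) + 4 := by linarith
  have hL1 : (1 : ℝ) ≤ ρ := by linarith only [hρ]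
  have hg1 : dist c₀ c + ((2 * (1280 * (9 * ρ) + 2388) + 4) + 10 * ρ + 20) ≤ r / 2 := by linarith only [hc₀, hρr, hρ]
  have hg2 : dist c₀ c + (2 * (1280 * (9 * ρ) + 2388) + 4) ≤ r / 4 := by linarith only [hc₀, hρr, hρ]
  obtain ⟨w, hwF, hwfin, hw0, hP, hE⟩ := step_harmonic hA hI hκ0 hκ hX hsep hequil hδ hδ1 hε0 hε hr hXb hπ hinj SR hSR χ hχ0
    hχ1abs hχone haff hrelax ha hBr hDu0 hDu1 hDu' hv' (ρ' := 2 * (1280 * (9 * ρ) + 2388) + 4) (L := ρ) hρ'1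
    hL1 hg1 hg2 (c₀ := c₀)
  rw [← hvdef] at hE
  have hs1 : ∀ (F : Finset (EuclideanSpace ℝ (Fin 3))), ∑ x ∈ F, ‖(π x - x) - aff x‖ ^ 2 = ∑ x ∈ F, ‖ut x‖ ^ 2 :=
    fun F => Finset.sum_congr rfl fun x _ => by rw [hudef]
  have hs3 : ∀ (F : Finset (EuclideanSpace ℝ (Fin 3))), ∑ q ∈ F, (dist q c₀)⁻¹ ^ 8 * ‖(π q - q) - aff q‖ ^ 2 =
      ∑ q ∈ F, (dist q c₀)⁻¹ ^ 8 * ‖ut q‖ ^ 2 :=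
    fun F => Finset.sum_congr rfl fun x _ => by rw [hudef]
  rw [hs1, hs1, hs3] at hE
  refine ⟨w, hwF, hwfin, fun p hp => ?_, hP, ?_⟩
  · have h := hw0 p hp
    rw [hvdef]
    simpa only using h
  · -- the energy in the currencies
    have hΦpos : 0 ≤ 𝚽[Du, r, δ] := by positivity
    have hD₀0 : (0 : ℝ) ≤ 2 * Du := by linarith only [hDu0]
    have hD₀1 : 2 * Du ≤ 1 / 10 := by linarith only [hDu1]
    have hsmall : ‖a 0 - a 1‖ + 2 * r * ‖B‖ ≤ 1 / 50 := by linarith only [ha, hBr]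
    have hD2 : ∀ x ∈ SR, ‖ut x‖ ≤ 2 * Du / 2 := fun x hx => by linarith only [hDu x hx]
    have hρ1 : (1 : ℝ) ≤ ρ := by linarith only [hρ]
    have hρρ' : ρ ≤ 2 * (1280 * (9 * ρ) + 2388) + 4 := by linarith only [hρ]
    have hgeom : 32 * ((2 * (1280 * (9 * ρ) + 2388) + 4) + 10 * ρ + 20) ≤ r := by linarith only [hρr]
    have hAφ : 0 ≤ Real.sqrt (32 * (2 * (1280 * (9 * ρ) + 2388) + 4) ^ 3) * 𝚽[Du, r, δ] := mul_nonneg (Real.sqrt_nonneg _) hΦpos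
    -- the shape of `step_harmonic` uses `D = Du`, that of `step_energy_le` `2 (D₀/2)` with `D₀ = 2Du`
    have e : 2 * ((2 * Du) / 2) = 2 * Du := by ring
    clear hforce hw0 hP
    exact step_energy_le_abs hA hI hκ0 hκ hX hequil hr hπ hinj SR hSR χ hχ0 hχS hχabs hχone haff (D₀ := 2 * Du) hD₀0
      hD₀1 hsmall v ut hvdef hudef hD2 hΛκ hv hc₀ φ hφdef hΦpos hφ hC
      hρ1 hmass hvD hsupp (ρ' := 2 * (1280 * (9 * ρ) + 2388) + 4) (L := ρ)
      (Aφ := Real.sqrt (32 * (2 * (1280 * (9 * ρ) + 2388) + 4) ^ 3) * 𝚽[Du, r, δ])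
      hρρ' hρ1 hgeom hAφ (w := w) (by rw [e]; exact hE)

end

end Summit.AtomisticToContinuum.Crystallization.Theorems.ExcessDecayLiouville

end
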